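import Summits.Ventures.PercRepro.S1FiveCircuitsSolidCaseOne
import Summits.Ventures.PercRepro.S1CoreCapSpreadChainFive

/-!
# PercRepro — THE SOLID ANALYSIS, THE SKELETON: `#5circ(e) ≤ max(16, Σ_{j ≤ 4} t(j))` AT NULLITY `4` MODULO THE PLANE-POOR PER-POINT TABLE
(p1, gen 33)

`proofs/P1-S2-CORANK6.md` §4l. The per-point cap `Q₅*_spread(4)` splits, in the contraction `N = M ／ {e}`, into CASE 1 — some
four-circuit of `N` spans a 6-point plane, i.e. some rank-`4` flat of `M` through `e` has `7` points — settled by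
`ncard_fiveCircuitsThrough_le_sixteen_of_seven_solid` (`≤ 16`), and CASE 2 — `N` is PLANE-POOR (every four-circuit spans a plane of
`≤ 5` points) — and, always, 8-SPREAD (`Spread8`: no set of nullity `4` on `≤ 8` points, inherited from `¬h4`; without it the table
fails at nullity `5`: two 4-lines through a point and three 3-lines through a new point give `11`). The class is deletion-closed (`planePoor_delete`, `spread8_delete`), so p3's deletion recursion, restated here without the
e-free hypothesis (`ncard_fourCircuits_le_sum_of_perPoint_planePoor`), bounds the four-circuits of `N` by `Σ_{j ≤ 4} t(j)` whenever every
plane-poor 8-spread finite matroid of nullity `j` has at most `t j` four-circuits through each point — THE PLANE-POOR PER-POINT TABLE, the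
configuration instances of §4l (`t = 1, 4, 5, 8` by the search, `Σ = 18`), which are the hypothesis `ht` here and are NOT proved in this
file. With the transfer lemmas for the contraction — `eRk_contract_singleton_add_one` (`r_N(X) + 1 = r_M(X ∪ {e})`),
`Matroid.contract_closure_eq`, `nullity_contract_singleton_of_not_isLoop` — and the injection
`ncard_fiveCircuitsThrough_le_ncard_fourCircuits_contract`, **`ncard_fiveCircuitsThrough_le_max_of_planePoor_table`** reads:
on a spread e-free core of nullity `4`, `#{five-circuits through e} ≤ max 16 (capSum t 4)`. So the hypothesis `h4` of
`ncard_fiveCircuits_le_thirteen_six_of_perPoint_four_five` is reduced to the plane-poor table at nullities `≤ 4`. Nothing about any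
cell is claimed. Axioms: standard.
-/

open scoped Matroid

namespace PercRepro

namespace S1

open Set

open FourCap

variable {α : Type}

/-- **The rank of a set in the contraction of a non-loop**: `r_{M ／ {e}}(X) + 1 = r_M(insert e X)` for `X ⊆ E`, `e ∉ X`. -/
theorem eRk_contract_singleton_add_one (M : Matroid α) {e : α} (he : M.IsNonloop e) {X : Set α} (hX : X ⊆ M.E)
    (heX : e ∉ X) : (M ／ {e}).eRk X + 1 = M.eRk (insert e X) := by
  obtain ⟨I, hI, heI⟩ := he.indep.subset_isBasis_of_subset (singleton_subset_iff.2 (mem_insert e X))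
    (insert_subset he.mem_ground hX)
  have h1 := hI.isBasis'.contract_isBasis_of_indep (J := {e}) (by rw [union_eq_left.2 heI]; exact hI.indep)
  rw [insert_sdiff_self_of_notMem heX] at h1
  rw [← h1.encard_eq_eRk, ← hI.encard_eq_eRk]
  exact Set.encard_sdiff_singleton_add_one (heI (mem_singleton e))

/-- **The five-circuits through `e` inject into the four-circuits of `M ／ {e}`** (`C ↦ C ∖ {e}`). -/
theorem ncard_fiveCircuitsThrough_le_ncard_fourCircuits_contract (M : Matroid α) [M.Finite] (e : α) :
    {C : Set α | M.IsCircuit C ∧ C.ncard = 5 ∧ e ∈ C}.ncard ≤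
      {D : Set α | (M ／ {e}).IsCircuit D ∧ D.ncard = 4}.ncard := by
  classical
  have hfin : {D : Set α | (M ／ {e}).IsCircuit D ∧ D.ncard = 4}.Finite :=
    (M ／ {e}).ground_finite.finite_subsets.subset (fun D hD => hD.1.subset_ground)
  refine Set.ncard_le_ncard_of_injOn (fun C : Set α => C \ {e}) ?_ ?_ hfin
  · rintro C ⟨hC, h5, heC⟩
    have hCfin : C.Finite := M.ground_finite.subset hC.subset_ground
    have hnt : C.Nontrivial := by
      have : Finite C := hCfin.to_subtype
      rw [← Set.one_lt_ncard_iff_nontrivial, h5]; norm_num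
    refine ⟨hC.contractElem_isCircuit hnt heC, ?_⟩
    rw [Set.ncard_sdiff_singleton_of_mem heC, h5]
  · rintro C ⟨-, -, heC⟩ C' ⟨-, -, heC'⟩ h
    simp only at h
    have h1 : C = insert e (C \ {e}) := by rw [Set.insert_sdiff_singleton, Set.insert_eq_of_mem heC]
    have h2 : C' = insert e (C' \ {e}) := by rw [Set.insert_sdiff_singleton, Set.insert_eq_of_mem heC']
    rw [h1, h2, h]

/-- **The plane-poor class**: every four-circuit spans a plane (its closure) of at most `5` points. -/
def PlanePoor (N : Matroid α) : Prop :=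
  ∀ D : Set α, N.IsCircuit D → D.ncard = 4 → (N.closure D).ncard ≤ 5

/-- **The plane-poor class is deletion-closed**: a four-circuit of `N ＼ {f}` is a four-circuit of `N`, and its closure in `N ＼ {f}` is
its closure in `N` minus `f`. -/
theorem planePoor_delete (N : Matroid α) [N.Finite] (hN : PlanePoor N) (f : α) : PlanePoor (N ＼ {f}) := by
  intro D hD h4
  rw [Matroid.delete_isCircuit_iff] at hD
  rw [Matroid.delete_closure_eq, hD.2.sdiff_eq_left]
  exact (ncard_sdiff_singleton_le _ _).trans (hN D hD.1 h4)

/-- **The 8-spread class**: no set of nullity `4` on `≤ 8` points (the contraction `M ／ {e}` of a spread core is 8-spread). -/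
def Spread8 (N : Matroid α) : Prop := ¬ ∃ W ⊆ N.E, W.ncard ≤ 8 ∧ W.encard = N.eRk W + 4

/-- **The 8-spread class is deletion-closed** (a set of `N ＼ {f}` has the rank it has in `N`). -/
theorem spread8_delete (N : Matroid α) (hN : Spread8 N) (f : α) : Spread8 (N ＼ {f}) := by
  rintro ⟨W, hW, h8, hW4⟩
  rw [Matroid.delete_ground] at hW
  refine hN ⟨W, hW.trans sdiff_subset, h8, ?_⟩
  rw [Matroid.delete_eq_restrict, Matroid.restrict_eRk_eq N hW] at hW4
  exact hW4

/-- **The contraction of a non-loop of a spread core is 8-spread**: a set `W` of `M ／ {e}` of nullity `4` on `≤ 8` points gives the set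
`insert e W` of `M` of nullity `4` on `≤ 9` points (`eRk_contract_singleton_add_one`). -/
theorem spread8_contract (M : Matroid α) [M.Finite] (hns : ¬ ∃ W ⊆ M.E, W.ncard ≤ 9 ∧ W.encard = M.eRk W + 4)
    {e : α} (he : M.IsNonloop e) : Spread8 (M ／ {e}) := by
  rintro ⟨W, hW, h8, hW4⟩
  rw [Matroid.contract_ground] at hW
  have heW : e ∉ W := fun h => (hW h).2 (mem_singleton e)
  have hWE : W ⊆ M.E := hW.trans sdiff_subset
  have hWf : W.Finite := M.ground_finite.subset hWE
  refine hns ⟨insert e W, insert_subset he.mem_ground hWE, ?_, ?_⟩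
  · rw [ncard_insert_of_notMem heW hWf]; omega
  · rw [encard_insert_of_notMem heW, hW4, ← eRk_contract_singleton_add_one M he hWE heW]
    ring

/-- **p3's deletion recursion for the four-circuits inside a deletion-closed class, without the e-free hypothesis**: if every member of
the class of nullity `j` has at most `q j` four-circuits through each point, a member of nullity `d` has at most `Σ_{j ≤ d} q j`
four-circuits (delete a point of a four-circuit: p2's split `ncard_fourCircuits_le_through_add_delete`, the nullity drops by one). -/
theorem ncard_fourCircuits_le_sum_of_perPoint_class (P : Matroid α → Prop)
    (hP : ∀ (N : Matroid α) [N.Finite] (x : α), P N → P (N ＼ {x})) (q : ℕ → ℕ)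
    (hq : ∀ (N : Matroid α) [N.Finite], P N → ∀ j : ℕ, N.E.encard = N.eRank + j → ∀ f ∈ N.E,
      {D : Set α | N.IsCircuit D ∧ D.ncard = 4 ∧ f ∈ D}.ncard ≤ q j)
    (N : Matroid α) [N.Finite] (hPN : P N) {d : ℕ} (hd : N.E.encard = N.eRank + d) :
    {D : Set α | N.IsCircuit D ∧ D.ncard = 4}.ncard ≤ (Finset.range (d + 1)).sum q := by
  suffices H : ∀ n : ℕ, ∀ (N : Matroid α) [N.Finite], N.E.ncard = n → P N →
      ∀ d : ℕ, N.E.encard = N.eRank + d →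
      {D : Set α | N.IsCircuit D ∧ D.ncard = 4}.ncard ≤ (Finset.range (d + 1)).sum q from
    H _ N rfl hPN d hd
  intro n
  induction n using Nat.strong_induction_on with
  | _ n ih =>
  intro N _ hn hPN d hd
  classical
  set S := {D : Set α | N.IsCircuit D ∧ D.ncard = 4} with hS
  by_cases hSe : S = ∅
  · rw [hSe, ncard_empty]; exact Nat.zero_le _
  obtain ⟨D₀, hD₀⟩ := nonempty_iff_ne_empty.2 hSe
  obtain ⟨f, hfD₀⟩ := hD₀.1.nonempty
  have hfE : f ∈ N.E := hD₀.1.subset_ground hfD₀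
  have hne : ¬ N.IsColoop f := hD₀.1.not_isColoop_of_mem hfD₀
  have hν : N✶.eRank = (d : ℕ∞) := by
    have h := _root_.Matroid.eRank_add_eRank_dual N
    rw [hd] at h
    exact WithTop.add_left_cancel (PercRepro.Matroid.eRank_ne_top_of_finite N) h
  have hdel := PercRepro.Matroid.dual_eRank_delete_singleton_add_one hfE hne
  rw [hν] at hdel
  have hfin' : (N ＼ {f})✶.eRank ≠ ⊤ := by
    intro h
    rw [h] at hdel
    exact absurd hdel (by simp)
  obtain ⟨d', hd'⟩ := ENat.ne_top_iff_exists.1 hfin'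
  have hdd' : d = d' + 1 := by
    rw [← hd'] at hdel
    exact_mod_cast hdel.symm
  have hd'enc : (N ＼ {f}).E.encard = (N ＼ {f}).eRank + d' := by
    have h := _root_.Matroid.eRank_add_eRank_dual (N ＼ {f})
    rw [← hd'] at h
    exact h.symm
  have hdelE : (N ＼ {f}).E.ncard < n := by
    rw [_root_.Matroid.delete_ground, ← hn, ← ncard_sdiff_singleton_add_one hfE N.ground_finite]
    omega
  have hsplit := S1.ncard_fourCircuits_le_through_add_delete N f
  rw [← hS] at hsplit
  have h1 := hq N hPN d hd f hfE
  have h2 := ih _ hdelE (N ＼ {f}) rfl (hP N f hPN) d' hd'enc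
  subst hdd'
  rw [Finset.sum_range_succ]
  have h2' : {D : Set α | (N ＼ {f}).IsCircuit D ∧ D.ncard = 4}.ncard ≤ ∑ x ∈ Finset.range (d' + 1), q x := h2
  omega

/-- **The four-circuits of a plane-poor matroid of nullity `d` number at most `capSum t d`** whenever the plane-poor per-point table
`t` holds up to nullity `d`. -/
theorem ncard_fourCircuits_le_capSum_of_planePoor (N : Matroid α) [N.Finite] (hN : PlanePoor N) (hN8 : Spread8 N) {d : ℕ}
    (hd : N.E.encard = N.eRank + d) (t : ℕ → ℕ)
    (ht : ∀ (N' : Matroid α) [N'.Finite], PlanePoor N' → Spread8 N' → ∀ j : ℕ, N'.E.encard = N'.eRank + j → ∀ f ∈ N'.E,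
      {D : Set α | N'.IsCircuit D ∧ D.ncard = 4 ∧ f ∈ D}.ncard ≤ t j) :
    {D : Set α | N.IsCircuit D ∧ D.ncard = 4}.ncard ≤ capSum t d :=
  ncard_fourCircuits_le_sum_of_perPoint_class (fun N' => PlanePoor N' ∧ Spread8 N')
    (fun N' _ x h => ⟨planePoor_delete N' h.1 x, spread8_delete N' h.2 x⟩) t
    (fun N' _ h j hj f hf => ht N' h.1 h.2 j hj f hf) N ⟨hN, hN8⟩ hd

/-- **THE SKELETON AT NULLITY `4`**: on a spread e-free core of nullity `4`, `#{five-circuits through e} ≤ max 16 (capSum t 4)`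
whenever the plane-poor per-point table `t` holds up to nullity `4` — Case 1 (a 7-point rank-`4` flat through `e`:
`ncard_fiveCircuitsThrough_le_sixteen_of_seven_solid`) or Case 2 (`M ／ {e}` is plane-poor: the recursion). -/
theorem ncard_fiveCircuitsThrough_le_max_of_planePoor_table (M : Matroid α) [M.Finite]
    (hfree : ∀ e ∈ M.E, ∃ A ⊆ M.E \ {e}, e ∉ M.closure A ∧ e ∉ M.closure ((M.E \ {e}) \ A))
    (hns : ¬ ∃ W ⊆ M.E, W.ncard ≤ 9 ∧ W.encard = M.eRk W + 4) (hd : M.E.encard = M.eRank + 4) (e : α)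
    (t : ℕ → ℕ)
    (ht : ∀ (N' : Matroid α) [N'.Finite], PlanePoor N' → Spread8 N' → ∀ j : ℕ, N'.E.encard = N'.eRank + j → ∀ f ∈ N'.E,
      {D : Set α | N'.IsCircuit D ∧ D.ncard = 4 ∧ f ∈ D}.ncard ≤ t j) :
    {C : Set α | M.IsCircuit C ∧ C.ncard = 5 ∧ e ∈ C}.ncard ≤ max 16 (capSum t 4) := by
  classical
  by_cases hempty : {C : Set α | M.IsCircuit C ∧ C.ncard = 5 ∧ e ∈ C} = ∅
  · rw [hempty, ncard_empty]; exact Nat.zero_le _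
  obtain ⟨C₀, hC₀⟩ := nonempty_iff_ne_empty.2 hempty
  have heE : e ∈ M.E := hC₀.1.subset_ground hC₀.2.2
  have hel : ¬ M.IsLoop e := by
    intro hl
    have h5 := hC₀.2.1
    rw [hl.eq_of_isCircuit_mem hC₀.1 hC₀.2.2, ncard_singleton] at h5
    exact absurd h5 (by norm_num)
  have henl : M.IsNonloop e := ⟨hel, heE⟩
  have hdN := nullity_contract_singleton_of_not_isLoop M heE hel hd
  by_cases hPP : PlanePoor (M ／ {e})
  · -- CASE 2: the recursion
    calc {C : Set α | M.IsCircuit C ∧ C.ncard = 5 ∧ e ∈ C}.ncard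
        ≤ {D : Set α | (M ／ {e}).IsCircuit D ∧ D.ncard = 4}.ncard :=
          ncard_fiveCircuitsThrough_le_ncard_fourCircuits_contract M e
      _ ≤ capSum t 4 := ncard_fourCircuits_le_capSum_of_planePoor (M ／ {e}) hPP (spread8_contract M hns henl) hdN t ht
      _ ≤ max 16 (capSum t 4) := le_max_right _ _
  · -- CASE 1: a four-circuit `D` of the contraction spans a 6-point plane, i.e. `cl_M(insert e D)` has `7` points
    unfold PlanePoor at hPP
    push Not at hPP
    obtain ⟨D, hD, h4, h6⟩ := hPP
    have hDE : D ⊆ M.E := hD.subset_ground.trans (M.contract_ground_subset_ground {e})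
    have heD : e ∉ D := fun h => (hD.subset_ground h).2 (mem_singleton e)
    have hX4 : M.eRk (insert e D) = 4 := by
      rw [← eRk_contract_singleton_add_one M henl hDE heD]
      have hDf : D.Finite := M.ground_finite.subset hDE
      have h := hD.eRk_add_one_eq
      rw [← hDf.cast_ncard_eq, h4] at h
      obtain ⟨r, hr⟩ := exists_eRk_eq_coe (M ／ {e}) D
      rw [hr] at h ⊢
      have h' : r + 1 = 4 := by exact_mod_cast h
      have : r = 3 := by omega
      rw [this]
      norm_num
    have heX : e ∈ M.closure (insert e D) := M.subset_closure _ (insert_subset heE hDE) (mem_insert e D)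
    have hcl : (M ／ {e}).closure D = M.closure (insert e D) \ {e} := by
      rw [Matroid.contract_closure_eq, union_singleton]
    have h7 : (M.closure (insert e D)).ncard = 7 := by
      have hle := S2.ncard_le_of_eRk_le_of_not_nullity M 4 9 (by norm_num) hns (M.closure_subset_ground _)
        (r := 4) (by norm_num) (by rw [M.eRk_closure_eq, hX4]; norm_num)
      have hge : 6 ≤ (M.closure (insert e D)).ncard - 1 := by
        rw [← ncard_sdiff_singleton_of_mem heX, ← hcl]
        omega
      omega
    exact (ncard_fiveCircuitsThrough_le_sixteen_of_seven_solid M hfree hns hd hX4 heX h7).trans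
      (le_max_left _ _)

/-- **THE SKELETON AT NULLITY `5`, WITH CASE 1 AS A HYPOTHESIS**: if every spread e-free core of nullity `5` with a 7-point rank-`4`
flat through a point `e'` has at most `c₅` five-circuits through `e'` (Case 1 at nullity `5`; `c₅ = 20` by §4l, `c₅ ≤ 28` suffices for
the cell), then on a spread e-free core of nullity `5`, `#{five-circuits through e} ≤ max c₅ (capSum t 5)` for the plane-poor table `t`. -/
theorem ncard_fiveCircuitsThrough_le_max_of_planePoor_table_five (M : Matroid α) [M.Finite]
    (hfree : ∀ e ∈ M.E, ∃ A ⊆ M.E \ {e}, e ∉ M.closure A ∧ e ∉ M.closure ((M.E \ {e}) \ A))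
    (hns : ¬ ∃ W ⊆ M.E, W.ncard ≤ 9 ∧ W.encard = M.eRk W + 4) (hd : M.E.encard = M.eRank + 5) (e : α)
    (t : ℕ → ℕ)
    (ht : ∀ (N' : Matroid α) [N'.Finite], PlanePoor N' → Spread8 N' → ∀ j : ℕ, N'.E.encard = N'.eRank + j → ∀ f ∈ N'.E,
      {D : Set α | N'.IsCircuit D ∧ D.ncard = 4 ∧ f ∈ D}.ncard ≤ t j)
    (c₅ : ℕ)
    (hcase1 : ∀ (M' : Matroid α) [M'.Finite],
      (∀ e ∈ M'.E, ∃ A ⊆ M'.E \ {e}, e ∉ M'.closure A ∧ e ∉ M'.closure ((M'.E \ {e}) \ A)) →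
      (¬ ∃ W ⊆ M'.E, W.ncard ≤ 9 ∧ W.encard = M'.eRk W + 4) → M'.E.encard = M'.eRank + 5 →
      ∀ (e' : α) (X : Set α), M'.eRk X = 4 → e' ∈ M'.closure X → (M'.closure X).ncard = 7 →
      {C : Set α | M'.IsCircuit C ∧ C.ncard = 5 ∧ e' ∈ C}.ncard ≤ c₅) :
    {C : Set α | M.IsCircuit C ∧ C.ncard = 5 ∧ e ∈ C}.ncard ≤ max c₅ (capSum t 5) := by
  classical
  by_cases hempty : {C : Set α | M.IsCircuit C ∧ C.ncard = 5 ∧ e ∈ C} = ∅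
  · rw [hempty, ncard_empty]; exact Nat.zero_le _
  obtain ⟨C₀, hC₀⟩ := nonempty_iff_ne_empty.2 hempty
  have heE : e ∈ M.E := hC₀.1.subset_ground hC₀.2.2
  have hel : ¬ M.IsLoop e := by
    intro hl
    have h5 := hC₀.2.1
    rw [hl.eq_of_isCircuit_mem hC₀.1 hC₀.2.2, ncard_singleton] at h5
    exact absurd h5 (by norm_num)
  have henl : M.IsNonloop e := ⟨hel, heE⟩
  have hdN := nullity_contract_singleton_of_not_isLoop M heE hel hd
  by_cases hPP : PlanePoor (M ／ {e})
  · calc {C : Set α | M.IsCircuit C ∧ C.ncard = 5 ∧ e ∈ C}.ncard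
        ≤ {D : Set α | (M ／ {e}).IsCircuit D ∧ D.ncard = 4}.ncard :=
          ncard_fiveCircuitsThrough_le_ncard_fourCircuits_contract M e
      _ ≤ capSum t 5 := ncard_fourCircuits_le_capSum_of_planePoor (M ／ {e}) hPP (spread8_contract M hns henl) hdN t ht
      _ ≤ max c₅ (capSum t 5) := le_max_right _ _
  · unfold PlanePoor at hPP
    push Not at hPP
    obtain ⟨D, hD, h4, h6⟩ := hPP
    have hDE : D ⊆ M.E := hD.subset_ground.trans (M.contract_ground_subset_ground {e})
    have heD : e ∉ D := fun h => (hD.subset_ground h).2 (mem_singleton e)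
    have hX4 : M.eRk (insert e D) = 4 := by
      rw [← eRk_contract_singleton_add_one M henl hDE heD]
      have hDf : D.Finite := M.ground_finite.subset hDE
      have h := hD.eRk_add_one_eq
      rw [← hDf.cast_ncard_eq, h4] at h
      obtain ⟨r, hr⟩ := exists_eRk_eq_coe (M ／ {e}) D
      rw [hr] at h ⊢
      have h' : r + 1 = 4 := by exact_mod_cast h
      have : r = 3 := by omega
      rw [this]
      norm_num
    have heX : e ∈ M.closure (insert e D) := M.subset_closure _ (insert_subset heE hDE) (mem_insert e D)
    have hcl : (M ／ {e}).closure D = M.closure (insert e D) \ {e} := by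
      rw [Matroid.contract_closure_eq, union_singleton]
    have h7 : (M.closure (insert e D)).ncard = 7 := by
      have hle := S2.ncard_le_of_eRk_le_of_not_nullity M 4 9 (by norm_num) hns (M.closure_subset_ground _)
        (r := 4) (by norm_num) (by rw [M.eRk_closure_eq, hX4]; norm_num)
      have hge : 6 ≤ (M.closure (insert e D)).ncard - 1 := by
        rw [← ncard_sdiff_singleton_of_mem heX, ← hcl]
        omega
      omega
    exact (hcase1 M hfree hns hd e (insert e D) hX4 heX h7).trans (le_max_left _ _)

/-- **THE `(13, 6)` SPREAD `s₅` CAP MODULO THE PLANE-POOR TABLE AND CASE 1 AT NULLITY `5`**: on the coloop-free spread e-free core of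
nullity `6` on `19` points, `s₅ ≤ ⌊19·(21 + max 16 (capSum t 4) + max c₅ (capSum t 5))/14⌋`. -/
theorem ncard_fiveCircuits_le_thirteen_six_of_planePoor_table (M : Matroid α) [M.Finite]
    (hfree : ∀ e ∈ M.E, ∃ A ⊆ M.E \ {e}, e ∉ M.closure A ∧ e ∉ M.closure ((M.E \ {e}) \ A))
    (hns : ¬ ∃ W ⊆ M.E, W.ncard ≤ 9 ∧ W.encard = M.eRk W + 4) (hd : M.E.encard = M.eRank + 6)
    (hn : M.E.ncard = 19) (hK : ∀ e, ¬ M.IsColoop e) (t : ℕ → ℕ)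
    (ht : ∀ (N' : Matroid α) [N'.Finite], PlanePoor N' → Spread8 N' → ∀ j : ℕ, N'.E.encard = N'.eRank + j → ∀ f ∈ N'.E,
      {D : Set α | N'.IsCircuit D ∧ D.ncard = 4 ∧ f ∈ D}.ncard ≤ t j)
    (c₅ : ℕ)
    (hcase1 : ∀ (M' : Matroid α) [M'.Finite],
      (∀ e ∈ M'.E, ∃ A ⊆ M'.E \ {e}, e ∉ M'.closure A ∧ e ∉ M'.closure ((M'.E \ {e}) \ A)) →
      (¬ ∃ W ⊆ M'.E, W.ncard ≤ 9 ∧ W.encard = M'.eRk W + 4) → M'.E.encard = M'.eRank + 5 →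
      ∀ (e' : α) (X : Set α), M'.eRk X = 4 → e' ∈ M'.closure X → (M'.closure X).ncard = 7 →
      {C : Set α | M'.IsCircuit C ∧ C.ncard = 5 ∧ e' ∈ C}.ncard ≤ c₅) :
    {C : Set α | M.IsCircuit C ∧ C.ncard = 5}.ncard ≤
      19 * (21 + max 16 (capSum t 4) + max c₅ (capSum t 5)) / 14 :=
  ncard_fiveCircuits_le_thirteen_six_of_perPoint_four_five M hfree hns hd hn hK (max 16 (capSum t 4))
    (max c₅ (capSum t 5))
    (fun M' _ hfree' hns' hd' e _ => ncard_fiveCircuitsThrough_le_max_of_planePoor_table M' hfree' hns' hd' e t ht)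
    (fun M' _ hfree' hns' hd' e _ =>
      ncard_fiveCircuitsThrough_le_max_of_planePoor_table_five M' hfree' hns' hd' e t ht c₅ hcase1)

/-- **The plane-poor per-point table of the search** (`§4l`): `t(0 … 5) = 0, 1, 4, 5, 8, 9`, the plain bound `C(j + 2, 3)` beyond. -/
def tPoor (j : ℕ) : ℕ :=
  if j = 0 then 0 else if j = 1 then 1 else if j = 2 then 4 else if j = 3 then 5 else if j = 4 then 8
    else if j = 5 then 9 else (j + 2).choose 3

/-- `Σ_{j ≤ 4} tPoor j = 18`. -/
theorem capSum_tPoor_four : capSum tPoor 4 = 18 := by decide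

/-- `Σ_{j ≤ 5} tPoor j = 27`. -/
theorem capSum_tPoor_five : capSum tPoor 5 = 27 := by decide

/-- **`s₅ ≤ 90` ON THE `(13, 6)` CORE, MODULO THE SEARCH TABLE AND CASE 1 AT NULLITY `5` WITH THE BOUND `28`**: what S2 §(ag)'s rows
`t ≤ 3` need (`q₄ + q₅ ≤ 18 + 28 = 46`, `⌊19·67/14⌋ = 90`). -/
theorem ncard_fiveCircuits_le_ninety_thirteen_six_of_tPoor (M : Matroid α) [M.Finite]
    (hfree : ∀ e ∈ M.E, ∃ A ⊆ M.E \ {e}, e ∉ M.closure A ∧ e ∉ M.closure ((M.E \ {e}) \ A))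
    (hns : ¬ ∃ W ⊆ M.E, W.ncard ≤ 9 ∧ W.encard = M.eRk W + 4) (hd : M.E.encard = M.eRank + 6)
    (hn : M.E.ncard = 19) (hK : ∀ e, ¬ M.IsColoop e)
    (ht : ∀ (N' : Matroid α) [N'.Finite], PlanePoor N' → Spread8 N' → ∀ j : ℕ, N'.E.encard = N'.eRank + j → ∀ f ∈ N'.E,
      {D : Set α | N'.IsCircuit D ∧ D.ncard = 4 ∧ f ∈ D}.ncard ≤ tPoor j)
    (hcase1 : ∀ (M' : Matroid α) [M'.Finite],
      (∀ e ∈ M'.E, ∃ A ⊆ M'.E \ {e}, e ∉ M'.closure A ∧ e ∉ M'.closure ((M'.E \ {e}) \ A)) →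
      (¬ ∃ W ⊆ M'.E, W.ncard ≤ 9 ∧ W.encard = M'.eRk W + 4) → M'.E.encard = M'.eRank + 5 →
      ∀ (e' : α) (X : Set α), M'.eRk X = 4 → e' ∈ M'.closure X → (M'.closure X).ncard = 7 →
      {C : Set α | M'.IsCircuit C ∧ C.ncard = 5 ∧ e' ∈ C}.ncard ≤ 28) :
    {C : Set α | M.IsCircuit C ∧ C.ncard = 5}.ncard ≤ 90 := by
  have h := ncard_fiveCircuits_le_thirteen_six_of_planePoor_table M hfree hns hd hn hK tPoor ht 28 hcase1
  rw [capSum_tPoor_four, capSum_tPoor_five] at h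
  exact h.trans (le_of_eq (by decide))

end S1

end PercRepro
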